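import Summits.QuantumFields.BalabanUV.T4Continuum.E3Cert.E3PolyCertZ
/-! E3 certificate package `ZL2d4C0half` — module `D_i3` ((4,2,1) block, d = 4, L = 2, type A small-field hypothesis c₀ = ½ ((x_t)₀ ≥ ½ on every link), γ = 923∕1024, M = 2²¹; emitter `bal_e3_lean_emit.py` output for
`block-L2d4-su2-c0half-dyadic.json`, lane `run/shared/lean/ttrl/balaban-calc/e3/lean-draft/tree/zL2d4C0half/D_i3.lean`; TREE COPY by the substrate cell (seat p3), typer
rulings (μ3)∕(ν2) = FINAL (μ6), journal l.19196 ∕ l.20020, following the E3 PILOT's scripted road (`substrate/p3/E3-PILOT.md` §1): import prefix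
substituted and one-line docstrings added BY SCRIPT, no literal touched).  Meaning of the certificate: see `Data.lean` ∕ `Main.lean` of this package
and the checker `E3Cert/E3PolyCertZ*.lean`.  HONEST: certified computation on ONE small block — NOT Prop. (1.8), NOT an input of any NE row today,
NOT infinite volume ∕ mass gap ∕ Clay. -/
set_option maxRecDepth 200000
set_option maxHeartbeats 0
namespace E3Z
/-- E3 certificate `zL2d4C0half` component: `zL2d4C0half_i3blk` (lane output, transcribed verbatim; see the module docstring). -/
def zL2d4C0half_i3blk : GramBlock := { rows := [(0,8),(0,9),(0,10),(0,11),(0,40),(0,41),(0,42),(0,43)], gden := 1048576, gnum := [[(Int.ofNat 213),(Int.ofNat 0),(Int.ofNat 0),(Int.ofNat 0),(Int.negSucc 20),(Int.ofNat 0),(Int.ofNat 0),(Int.ofNat 0)],[(Int.ofNat 0),(Int.ofNat 213),(Int.ofNat 0),(Int.ofNat 0),(Int.ofNat 0),(Int.negSucc 20),(Int.ofNat 0),(Int.ofNat 0)],[(Int.ofNat 0),(Int.ofNat 0),(Int.ofNat 213),(Int.ofNat 0),(Int.ofNat 0),(Int.ofNat 0),(Int.negSucc 20),(Int.ofNat 0)],[(Int.ofNat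 0),(Int.ofNat 0),(Int.ofNat 0),(Int.ofNat 213),(Int.ofNat 0),(Int.ofNat 0),(Int.ofNat 0),(Int.negSucc 20)],[(Int.negSucc 20),(Int.ofNat 0),(Int.ofNat 0),(Int.ofNat 0),(Int.ofNat 213),(Int.ofNat 0),(Int.ofNat 0),(Int.ofNat 0)],[(Int.ofNat 0),(Int.negSucc 20),(Int.ofNat 0),(Int.ofNat 0),(Int.ofNat 0),(Int.ofNat 213),(Int.ofNat 0),(Int.ofNat 0)],[(Int.ofNat 0),(Int.ofNat 0),(Int.negSucc 20),(Int.ofNat 0),(Int.ofNat 0),(Int.ofNat 0),(Int.ofNat 213),(Int.ofNat 0)],[(Int.ofNat 0),(Int.ofNat 0),(Int.ofNat 0),(Int.negSucc 20),(Int.ofNat 0),(Int.ofNat 0),(Int.ofNat 0),(Int.ofNat 213)]], lden := 24, lnum := [[(Int.ofNat 177220)],[(Int.ofNat 0),(Int.ofNat 177220)],[(Int.ofNat 0),(Int.ofNat 0),(Int.ofNat 177220)],[(Int.ofNat 0),(Int.ofNat 0),(Int.ofNat 0),(Int.ofNat 177220)],[(Int.negSucc 31808),(Int.ofNat 0),(Int.ofNat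 0),(Int.ofNat 0),(Int.ofNat 174342)],[(Int.ofNat 0),(Int.negSucc 31808),(Int.ofNat 0),(Int.ofNat 0),(Int.ofNat 0),(Int.ofNat 174342)],[(Int.ofNat 0),(Int.ofNat 0),(Int.negSucc 31808),(Int.ofNat 0),(Int.ofNat 0),(Int.ofNat 0),(Int.ofNat 174342)],[(Int.ofNat 0),(Int.ofNat 0),(Int.ofNat 0),(Int.negSucc 31808),(Int.ofNat 0),(Int.ofNat 0),(Int.ofNat 0),(Int.ofNat 174342)]] }
/-- E3 certificate `zL2d4C0half` component: `zL2d4C0half_i3` (lane output, transcribed verbatim; see the module docstring). -/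
def zL2d4C0half_i3 : Poly × GramBlock × ℕ := ([([],(Int.negSucc 0)),([(12,1)],(Int.ofNat 2))], zL2d4C0half_i3blk, 1)
end E3Z
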